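import Summits.BirchSwinnertonDyer.BirchSwinnertonDyer.Theorems.EisensteinPrimesBSDpOnCellCIsogenyNormalisation
import Summits.BirchSwinnertonDyer.BirchSwinnertonDyer.Theorems.EisensteinPrimesBSDpOnCellCSplitNormalisation
import HarnessLib

/-!
# Crux 4 `BSDpOnCellC` (stmt-BirchSwinnertonDyer-19034), line b1 — `CellC` REDUCES TO THE CURVES AT KELLER–YIN's NORMALISED LATTICE
# at the `BSD(E,p)` level, modulo Cassels / GZK / modularity ONLY: the inline [NORM] of p679623 is DISCHARGED
# (cell `bsd-eis`, width seat `bsd-line-x2-p2` gen 11; skeleton of record UNCHANGED, W-79)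

WHY. p679623 (`SplitMultNormalisation.bsdp_of_cellC_split_of_normalised`, g10) showed: GRANTED the inline sentence [NORM] (`hnorm`: every
globally minimal `W/ℚ` with `E[p]` reducible and split multiplicative reduction at an odd `p` is `ℚ`-isogenous to a globally minimal `W'` all
of whose rational `p`-lines are ramified at `p`, with at most one rational `p`-line) and the three published conjuncts Cassels
(`bsdRHS_eq_of_isIsogenous`), GZK (`rank_eq_analyticRank_of_analyticRank_le_one`) and modularity (`hasEntireLFunction_rat`) of
`stub_publishedFacts`, «`BSDp` for every NORMALISED split X2c pair» ⟹ «`BSDp` for EVERY split X2c pair». The companion file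
`…BSDpOnCellCIsogenyNormalisation` (this seat, gen 11) PROVES [NORM] in the kernel (`IsogenyNormalisation.hnorm_holds`, unconditional: the
isogeny walk terminated by Shafarevich `WeierstrassCurve.finite_isogenyClass_holds` + `degree_eq_of_isCyclic`), for every odd MULTIPLICATIVE
prime. Hence:

* `bsdp_of_cellC_split_of_normalised_kernel` — p679623 with `hnorm` REMOVED (same `hroad` shape: both binders (hlat), (huniq));
* `bsdp_of_cellC_of_hlat` — SIGN-FREE and with the SINGLE binder: if `BSDp W' p` holds for every X2c pair `(W', p)` whose rational
  `p`-lines are all ramified at `p` (the x1 line's `hlat`; (huniq) is automatic at `p ‖ N`, p679932 §2), then `BSDp W p` holds for EVERY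
  X2c pair `(W, p)` — modulo Cassels / GZK / modularity only. (`CellC` = analytic rank `1` ∧ `p ≠ 2` ∧ `Red` ∧ `Mult` is a `ℚ`-isogeny
  invariant, `X2.cellC_iff_of_isIsogenous`; `BSD(·,p)` passes along a `ℚ`-isogeny at analytic rank `≤ 1`, `X2.bsdp_of_isIsogenous_of_bsdp`.)
* `bsdpOnCellC_iff_hlat` — the crux BY NAME is EQUIVALENT, modulo the same three PUB facts, to its restriction to the hlat sub-cell.

So a LEAD's v13 cut «`stub_imprimitiveCount.2` ↦ conj. 2 + hlat» (g8–g10's recommendation; p679932 is conj. 2 + hlat from six PUB + [BR𝟙] +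
[BRω-split] + [AN-split]) needs NO new published input for the normalisation: compose the hlat-restricted road with `bsdp_of_cellC_of_hlat`.

HONEST FRAMING: helper theorems only (0 defs, 0 named facts introduced, 0 sorry); CONDITIONAL on the three named published facts (Cassels,
GZK, modularity) exactly as p679623; closes no stub of b1 v12; no summit statement / BSD / MC / IMC is proved for any curve; 0 cells /
labels / tiers move.

References: [KellerYin2024] §0.1 L262–263, §1.3 L886 (arXiv:2402.12781v2); [Cassels1965ArithmeticVIII]; [MilneADT2006] Thm. I.7.3;
[SilvermanAEC2009] Cor. IX.6.2, III.4.12, VII.7.2; [GrossZagier1986] / [Kolyvagin1990] (GZK, by name); cell files `X2/IsogenyClassStability`,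
`X2/RankOneHeegner` (b2b-bsdres); p679623, p679932 (g10); `…IsogenyNormalisation` (g11).
-/

set_option autoImplicit false
set_option linter.dupNamespace false -- the summit namespace `…BirchSwinnertonDyer.BirchSwinnertonDyer.Theorems` (Sub = Summit, D-0017) trips it

noncomputable section

open scoped Classical

namespace Summit.BirchSwinnertonDyer.BirchSwinnertonDyer.Theorems.SplitMultNormalisationKernel

open WeierstrassCurve NumberField IsDedekindDomain Field
open Literature.NumberTheory.EllipticCurves Literature.NumberTheory.EllipticCurves.Rank1Residual
  Summit.BirchSwinnertonDyer.Rank1Residual Summit.BirchSwinnertonDyer.Rank1Residual.X2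

/-- **p679623 with [NORM] discharged.** Cassels + GZK + modularity + «`BSDp` for every split X2c pair at Keller–Yin's normalised lattice
(hlat ∧ huniq)» ⟹ `BSDp` for EVERY split X2c pair; the normalisation hypothesis `hnorm` of
`SplitMultNormalisation.bsdp_of_cellC_split_of_normalised` is the tree theorem `IsogenyNormalisation.hnorm_holds`.
[cite: KellerYin2024, §0.1 (arXiv:2402.12781v2 TeX L262–263: "We can assume this since … the BSD Conjecture is invariant under isogenies")]
[cite: Cassels1965ArithmeticVIII] [cite: MilneADT2006, Thm. I.7.3] [cite: SilvermanAEC2009, Cor. IX.6.2 and Prop. III.4.12] -/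
theorem bsdp_of_cellC_split_of_normalised_kernel
    (hCassels : bsdRHS_eq_of_isIsogenous) (hGZK : rank_eq_analyticRank_of_analyticRank_le_one)
    (hmod : hasEntireLFunction_rat) (p : ℕ) [Fact p.Prime]
    (hroad : ∀ (W' : WeierstrassCurve ℚ) [W'.IsElliptic] [W'.IsGloballyMinimal],
      CellC W' p → W'.HasSplitMultiplicativeReductionAtPrime p →
      (∀ Φ : AddSubgroup (geomTorsion W' (p : ℤ)), IsRationalLine W' p Φ → ¬ LineUnramifiedAt W' p Φ) →
      (∀ Φ Φ' : AddSubgroup (geomTorsion W' (p : ℤ)), IsRationalLine W' p Φ → IsRationalLine W' p Φ' → Φ = Φ') →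
      BSDp W' p)
    (W : WeierstrassCurve ℚ) [W.IsElliptic] [W.IsGloballyMinimal] (hc : CellC W p)
    (hsplit : W.HasSplitMultiplicativeReductionAtPrime p) : BSDp W p :=
  SplitMultNormalisation.bsdp_of_cellC_split_of_normalised hCassels hGZK hmod IsogenyNormalisation.hnorm_holds p hroad W hc
    hsplit

/-- **X2c REDUCES TO ITS hlat SUB-CELL at the `BSD(E,p)` level, both signs, single binder.** Granted Cassels (`bsdRHS_eq_of_isIsogenous`),
GZK (`rank_eq_analyticRank_of_analyticRank_le_one`) and modularity (`hasEntireLFunction_rat`): if `BSDp W' p` holds for every X2c pair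
`(W', p)` (`CellC W' p`: analytic rank `1`, `p` odd, `E[p]` reducible, `p` multiplicative) whose rational `p`-lines are ALL RAMIFIED at `p`,
then `BSDp W p` holds for every X2c pair `(W, p)`. Proof: `IsogenyNormalisation.exists_isIsogenous_forall_not_lineUnramifiedAt` (the walk,
unconditional) gives a `ℚ`-isogenous globally minimal `W'` with (hlat); `CellC` transports (`X2.cellC_iff_of_isIsogenous`); `BSD(·,p)` comes
back along the isogeny at analytic rank `≤ 1` (`X2.bsdp_of_isIsogenous_of_bsdp`).
[cite: KellerYin2024, §0.1 (arXiv:2402.12781v2 TeX L262–263) and §1.3 (L886)] [cite: Cassels1965ArithmeticVIII] [cite: MilneADT2006, Thm. I.7.3]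
[cite: SilvermanAEC2009, Cor. IX.6.2, Prop. III.4.12 and Cor. VII.7.2] -/
theorem bsdp_of_cellC_of_hlat
    (hCassels : bsdRHS_eq_of_isIsogenous) (hGZK : rank_eq_analyticRank_of_analyticRank_le_one)
    (hmod : hasEntireLFunction_rat) (p : ℕ) [Fact p.Prime]
    (hroad : ∀ (W' : WeierstrassCurve ℚ) [W'.IsElliptic] [W'.IsGloballyMinimal], CellC W' p →
      (∀ Φ : AddSubgroup (geomTorsion W' (p : ℤ)), IsRationalLine W' p Φ → ¬ LineUnramifiedAt W' p Φ) → BSDp W' p)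
    (W : WeierstrassCurve ℚ) [W.IsElliptic] [W.IsGloballyMinimal] (hc : CellC W p) : BSDp W p := by
  have hp2 : p ≠ 2 := hc.2.1
  have hmult : W.HasMultiplicativeReductionAtPrime p := hc.2.2.2
  obtain ⟨W', hE', hmin', hiso, hlat', -⟩ :=
    IsogenyNormalisation.exists_isIsogenous_forall_not_lineUnramifiedAt W p hp2 hmult
  have hc' : CellC W' p := (cellC_iff_of_isIsogenous (p := p) hiso).mp hc
  have h' : BSDp W' p := hroad W' hc' hlat'
  have hr' : W'.analyticRank ≤ 1 := by rw [hc'.1]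
  exact bsdp_of_isIsogenous_of_bsdp hCassels hGZK hmod W' W hiso.symm_of_charZero p hr' h'

/-- **Crux 4 BY NAME ⟺ its hlat restriction, modulo Cassels / GZK / modularity.** `BSDpOnCellC` (= `X2.TargetC`: `∀ W p, CellC W p → BSDp W p`)
holds iff `BSDp W' p` holds for every X2c pair `(W', p)` all of whose rational `p`-lines are ramified at `p`. (`→` is restriction; `←` is
`bsdp_of_cellC_of_hlat`.) So a re-cut of line b1 that proves conj. 2 of the wall only under the binder (hlat) (p679932's shape) loses nothing.
[cite: KellerYin2024, §0.1 (arXiv:2402.12781v2 TeX L262–263)] [cite: Cassels1965ArithmeticVIII] [cite: MilneADT2006, Thm. I.7.3] -/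
theorem bsdpOnCellC_iff_hlat
    (hCassels : bsdRHS_eq_of_isIsogenous) (hGZK : rank_eq_analyticRank_of_analyticRank_le_one)
    (hmod : hasEntireLFunction_rat) :
    Summit.BirchSwinnertonDyer.BirchSwinnertonDyer.Theses.EisensteinPrimes.BSDpOnCellC ↔
      ∀ (W' : WeierstrassCurve ℚ) [W'.IsElliptic] [W'.IsGloballyMinimal] (p : ℕ) [Fact p.Prime], CellC W' p →
        (∀ Φ : AddSubgroup (geomTorsion W' (p : ℤ)), IsRationalLine W' p Φ → ¬ LineUnramifiedAt W' p Φ) → BSDp W' p := by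
  unfold Summit.BirchSwinnertonDyer.BirchSwinnertonDyer.Theses.EisensteinPrimes.BSDpOnCellC TargetC
  exact ⟨fun h W' _ _ p _ hc _ ↦ h W' p hc,
    fun h W _ _ p _ hc ↦ bsdp_of_cellC_of_hlat hCassels hGZK hmod p (fun W' _ _ hc' hlat' ↦ h W' p hc' hlat') W hc⟩

end Summit.BirchSwinnertonDyer.BirchSwinnertonDyer.Theorems.SplitMultNormalisationKernel

end
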